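import Summits.KontsevichZagierPeriods.KontsevichZagierPeriods.Theorems.LinRedNormalFormArrangementNormalFormSeparateThreeHHKMonoSplit

/-!
# The monomial split under an almost-decreasing weight in any number of variables

(Line `janus-bands`, crux `ArrangementNormalForm`, stub `stub_separateHigh_hH`, part `AllHHMonoSplit`
of the dimension-generic wall-invariant termwise-split lemma, base dimension `b + 1 ≥ 4` with
fibres; namespace `SepAll`.)
The local analysis of the Taylor pieces at a base point of `ℝ^D` uses NESTED thin sectors of depth
`D` with blown-up coordinates `w = (w₀, …, w_{D-1})` in an open BOX `box δ = ∏ (0, δ l)` and a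
weight `W ≥ 0` on the big box `box (4δ)` that is ALMOST DECREASING TOWARDS THE CORNER at ratio `4`
in every variable (`W w ≤ K · W w'` for `w ≤ w' ≤ 4 w` coordinatewise). This file sets up the boxes
(`box`, their product measure `boxMeasure`, the one-coordinate peeling formulas
`lintegral_boxMeasure_peel`, `lintegral_box_cons`, `lintegral_box_cons'` — Tonelli along
`ℝ^{n+1} ≅ ℝ × ℝ^n`), the monomials `mono e w = ∏ w_l^{e_l}` and tensor polynomials `pevn c`, and
proves the `n`-VARIABLE MONOMIAL SPLIT (`monoSplit_le`, quantitative, by induction on `n` from the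
quantitative one-variable split `SepHHK.monoSplit₁_le`; qualitative form `monoSplit_lt_top`,
registered as `separateAllHH_monoSplit`): if `∑ c e · w^e` is absolutely `W`-integrable on the big
box then every monomial `c e · w^e` is, on the small box.
-/

noncomputable section

open Set MeasureTheory
open scoped ENNReal

namespace Summit.KontsevichZagierPeriods.ArrangementNormalForm.JanusBands

namespace SepAll

open SepTwo SepHHK

variable {n d : ℕ}

/-! ### Boxes -/

/-- The open box `∏_l (0, δ l)` of blown-up coordinates. -/
def box (δ : Fin n → ℝ) : Set (Fin n → ℝ) := Set.univ.pi fun l => Ioo 0 (δ l)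

/-- The product of the Lebesgue measures restricted to the sides of the box. -/
def boxMeasure (δ : Fin n → ℝ) : Measure (Fin n → ℝ) :=
  Measure.pi fun l => (volume : Measure ℝ).restrict (Ioo 0 (δ l))

/-- Membership in a box. -/
theorem mem_box {δ w : Fin n → ℝ} : w ∈ box δ ↔ ∀ l, 0 < w l ∧ w l < δ l := by
  simp [box]

/-- Boxes are measurable. -/
theorem measurableSet_box (δ : Fin n → ℝ) : MeasurableSet (box δ) :=
  MeasurableSet.univ_pi fun _ => measurableSet_Ioo

/-- Lebesgue measure restricted to a box is the box measure. -/
theorem restrict_box (δ : Fin n → ℝ) : (volume : Measure (Fin n → ℝ)).restrict (box δ) = boxMeasure δ := by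
  rw [box, boxMeasure, volume_pi, Measure.restrict_pi_pi]

/-- The box measure is sigma-finite. -/
instance boxMeasure.sigmaFinite (δ : Fin n → ℝ) : SigmaFinite (boxMeasure δ) := by
  unfold boxMeasure; infer_instance

/-- Boxes are monotone in the scale. -/
theorem box_mono {δ δ' : Fin n → ℝ} (h : ∀ l, δ l ≤ δ' l) : box δ ⊆ box δ' :=
  fun _ hw => mem_box.2 fun l => ⟨(mem_box.1 hw l).1, (mem_box.1 hw l).2.trans_le (h l)⟩

/-! ### Peeling one coordinate -/

/-- Inserting a coordinate is measurable. -/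
theorem measurable_insertNth (i : Fin (n + 1)) :
    Measurable fun p : ℝ × (Fin n → ℝ) => (i.insertNth p.1 p.2 : Fin (n + 1) → ℝ) :=
  measurable_pi_iff.2 (i.forall_iff_succAbove.2
    ⟨by simpa using measurable_fst, fun j => by simpa using measurable_pi_iff.1 measurable_snd j⟩)

/-- `Fin.cons` is measurable. -/
theorem measurable_cons :
    Measurable fun p : ℝ × (Fin n → ℝ) => (Fin.cons p.1 p.2 : Fin (n + 1) → ℝ) :=
  measurable_pi_iff.2 (Fin.forall_fin_succ.2
    ⟨by simpa using measurable_fst, fun j => by simpa using measurable_pi_iff.1 measurable_snd j⟩)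

/-- `Fin.cons` with the arguments swapped is measurable. -/
theorem measurable_cons' :
    Measurable fun p : (Fin n → ℝ) × ℝ => (Fin.cons p.2 p.1 : Fin (n + 1) → ℝ) :=
  measurable_cons.comp measurable_swap

/-- **Peeling the coordinate `i`** (outer integral over the coordinate). -/
theorem lintegral_boxMeasure_peel (i : Fin (n + 1)) (δ : Fin (n + 1) → ℝ)
    (F : (Fin (n + 1) → ℝ) → ℝ≥0∞) (hF : Measurable F) :
    ∫⁻ w, F w ∂boxMeasure δ =
      ∫⁻ x in Ioo 0 (δ i), ∫⁻ w', F (i.insertNth x w') ∂boxMeasure (fun j => δ (i.succAbove j)) := by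
  have hmp := measurePreserving_piFinSuccAbove
    (fun l => (volume : Measure ℝ).restrict (Ioo 0 (δ l))) i
  have hg : Measurable fun p : ℝ × (Fin n → ℝ) => F (i.insertNth p.1 p.2) :=
    hF.comp (measurable_insertNth i)
  have h1 := hmp.lintegral_comp hg
  have h2 : (fun w : Fin (n + 1) → ℝ => F (i.insertNth
      ((MeasurableEquiv.piFinSuccAbove (fun _ => ℝ) i) w).1
      ((MeasurableEquiv.piFinSuccAbove (fun _ => ℝ) i) w).2)) = F := by
    funext w
    simp [MeasurableEquiv.piFinSuccAbove_apply]
  rw [h2] at h1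
  rw [boxMeasure, h1, lintegral_prod _ hg.aemeasurable]
  rfl

/-- **Peeling the coordinate `i`** (inner integral over the coordinate). -/
theorem lintegral_boxMeasure_peel' (i : Fin (n + 1)) (δ : Fin (n + 1) → ℝ)
    (F : (Fin (n + 1) → ℝ) → ℝ≥0∞) (hF : Measurable F) :
    ∫⁻ w, F w ∂boxMeasure δ =
      ∫⁻ w', (∫⁻ x in Ioo 0 (δ i), F (i.insertNth x w')) ∂boxMeasure (fun j => δ (i.succAbove j)) := by
  rw [lintegral_boxMeasure_peel i δ F hF]
  have hg : Measurable (Function.uncurry fun (x : ℝ) (w' : Fin n → ℝ) => F (i.insertNth x w')) :=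
    hF.comp (measurable_insertNth i)
  exact lintegral_lintegral_swap hg.aemeasurable

/-- **Peeling the first coordinate**, inner integral over it. -/
theorem lintegral_box_cons (δ : Fin (n + 1) → ℝ) (F : (Fin (n + 1) → ℝ) → ℝ≥0∞) (hF : Measurable F) :
    ∫⁻ w in box δ, F w = ∫⁻ w' in box (fun l => δ l.succ), ∫⁻ t in Ioo 0 (δ 0), F (Fin.cons t w') := by
  rw [restrict_box, restrict_box, lintegral_boxMeasure_peel' 0 δ F hF]
  simp only [Fin.insertNth_zero', Fin.succAbove_zero]

/-- **Peeling the first coordinate**, outer integral over it. -/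
theorem lintegral_box_cons' (δ : Fin (n + 1) → ℝ) (F : (Fin (n + 1) → ℝ) → ℝ≥0∞) (hF : Measurable F) :
    ∫⁻ w in box δ, F w = ∫⁻ t in Ioo 0 (δ 0), ∫⁻ w' in box (fun l => δ l.succ), F (Fin.cons t w') := by
  rw [restrict_box, restrict_box, lintegral_boxMeasure_peel 0 δ F hF]
  simp only [Fin.insertNth_zero', Fin.succAbove_zero]

/-! ### Monomials and tensor polynomials -/

/-- The monomial `∏ w_l ^ e_l`. -/
def mono (e : Fin n → ℕ) (w : Fin n → ℝ) : ℝ := ∏ l, w l ^ e l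

/-- The polynomial function with coefficient tensor `c` of multidegree `≤ (d, …, d)`. -/
def pevn (c : (Fin n → Fin (d + 1)) → ℝ) (w : Fin n → ℝ) : ℝ :=
  ∑ e, c e * mono (fun l => (e l : ℕ)) w

/-- Monomials are continuous. -/
theorem continuous_mono (e : Fin n → ℕ) : Continuous (mono e) := by
  unfold mono
  exact continuous_finsetProd _ fun l _ => (continuous_apply l).pow _

/-- Tensor polynomials are continuous. -/
theorem continuous_pevn (c : (Fin n → Fin (d + 1)) → ℝ) : Continuous (pevn c) := by
  unfold pevn
  exact continuous_finsetSum _ fun e _ => continuous_const.mul (continuous_mono _)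

/-- Monomials are non-negative on the positive orthant. -/
theorem mono_nonneg (e : Fin n → ℕ) {w : Fin n → ℝ} (hw : ∀ l, 0 ≤ w l) : 0 ≤ mono e w :=
  Finset.prod_nonneg fun l _ => pow_nonneg (hw l) _

/-- A monomial in `n + 1` variables splits off its first variable. -/
theorem mono_cons (j : ℕ) (e : Fin n → ℕ) (t : ℝ) (w : Fin n → ℝ) :
    mono (Fin.cons j e : Fin (n + 1) → ℕ) (Fin.cons t w) = t ^ j * mono e w := by
  simp [mono, Fin.prod_univ_succ]

/-- The exponent tensor of the tail. -/
theorem mono_coe_cons (e : Fin (n + 1) → Fin (d + 1)) (t : ℝ) (w : Fin n → ℝ) :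
    mono (fun l => (e l : ℕ)) (Fin.cons t w) = t ^ (e 0 : ℕ) * mono (fun l => (e l.succ : ℕ)) w := by
  simp [mono, Fin.prod_univ_succ]

/-- A tensor polynomial in `n + 1` variables as a polynomial in its first variable. -/
theorem pevn_cons (c : (Fin (n + 1) → Fin (d + 1)) → ℝ) (t : ℝ) (w : Fin n → ℝ) :
    pevn c (Fin.cons t w) = pev (fun j => pevn (fun e => c (Fin.cons j e)) w) t := by
  unfold pevn pev
  rw [← (Fin.consEquiv fun _ : Fin (n + 1) => Fin (d + 1)).sum_comp, Fintype.sum_prod_type]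
  refine Finset.sum_congr rfl fun j _ => ?_
  rw [Finset.sum_mul]
  refine Finset.sum_congr rfl fun e _ => ?_
  have h : mono (fun l => ((Fin.consEquiv (fun _ : Fin (n + 1) => Fin (d + 1)) (j, e) l : ℕ)))
      (Fin.cons t w) = t ^ (j : ℕ) * mono (fun l => (e l : ℕ)) w := by
    rw [mono_coe_cons]
    simp [Fin.consEquiv]
  rw [h]
  simp only [Fin.consEquiv, Equiv.coe_fn_mk]
  ring

/-! ### The monomial split in `n` variables -/

/-- **The quantitative monomial split in `n` variables.** There is a constant `A < ∞` (depending
on `n, d` only) such that for every measurable weight `W` on the big box `box (4δ)` which is almost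
decreasing towards the corner at ratio `4` with constant `K < ∞`, every coefficient tensor `c` and
every exponent `e`:
`∫_{box δ} |c e| w^e · W ≤ A K^n ∫_{box (4δ)} |∑ c e' w^{e'}| · W`. -/
theorem monoSplit_le (n d : ℕ) : ∃ A : ℝ≥0∞, A ≠ ∞ ∧
    ∀ (c : (Fin n → Fin (d + 1)) → ℝ) (W : (Fin n → ℝ) → ℝ≥0∞), Measurable W →
    ∀ K : ℝ≥0∞, K ≠ ∞ → ∀ δ : Fin n → ℝ,
    (∀ w w' : Fin n → ℝ, (∀ l, 0 < w l) → (∀ l, w l ≤ w' l) → (∀ l, w' l ≤ 4 * w l) →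
      (∀ l, w' l < 4 * δ l) → W w ≤ K * W w') →
    ∀ e : Fin n → Fin (d + 1),
      ∫⁻ w in box δ, ENNReal.ofReal (|c e| * mono (fun l => (e l : ℕ)) w) * W w ≤
        A * K ^ n * ∫⁻ w in box (fun l => 4 * δ l), ENNReal.ofReal |pevn c w| * W w := by
  induction n with
  | zero =>
    refine ⟨1, ENNReal.one_ne_top, ?_⟩
    intro c W _ K _ δ _ e
    have hbox : ∀ δ' : Fin 0 → ℝ, box δ' = univ := fun δ' =>
      eq_univ_of_forall fun w => mem_box.2 fun l => l.elim0
    have he : ∀ e' : Fin 0 → Fin (d + 1), e' = e := fun e' => funext fun l => l.elim0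
    have hpev : ∀ w, pevn c w = c e := by
      intro w
      unfold pevn
      rw [Fintype.sum_subsingleton _ e]
      simp [mono]
    rw [hbox, hbox, pow_zero, one_mul, one_mul]
    refine lintegral_mono fun w => ?_
    rw [hpev w]
    simp [mono]
  | succ n ih =>
    obtain ⟨An, hAn, hn⟩ := ih
    obtain ⟨A₁, hA₁, h₁⟩ := monoSplit₁_le d
    refine ⟨An * A₁, ENNReal.mul_ne_top hAn hA₁, ?_⟩
    intro c W hW K hK δ hmono e
    -- notation
    set j : Fin (d + 1) := e 0 with hj
    set e' : Fin n → Fin (d + 1) := fun l => e l.succ with he'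
    set cj : Fin (d + 1) → (Fin n → Fin (d + 1)) → ℝ := fun j' e'' => c (Fin.cons j' e'') with hcj
    have hce : c e = cj j e' := by
      simp only [hcj, hj, he']
      exact congrArg c (Fin.cons_self_tail e).symm
    -- the partially integrated weight
    set Wj : (Fin n → ℝ) → ℝ≥0∞ := fun w' =>
      ∫⁻ t in Ioo 0 (δ 0), ENNReal.ofReal (t ^ (j : ℕ)) * W (Fin.cons t w') with hWj
    have hWm2 : Measurable fun p : (Fin n → ℝ) × ℝ =>
        ENNReal.ofReal (p.2 ^ (j : ℕ)) * W (Fin.cons p.2 p.1) :=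
      (ENNReal.measurable_ofReal.comp (measurable_snd.pow_const _)).mul (hW.comp measurable_cons')
    have hWjm : Measurable Wj := hWm2.lintegral_prod_right'
    have hWcons : ∀ w' : Fin n → ℝ, Measurable fun t : ℝ => W (Fin.cons t w') := fun w' =>
      hW.comp (measurable_cons.comp (measurable_id.prodMk measurable_const))
    -- monotonicity of the partially integrated weight
    have hmonoj : ∀ w w' : Fin n → ℝ, (∀ l, 0 < w l) → (∀ l, w l ≤ w' l) →
        (∀ l, w' l ≤ 4 * w l) → (∀ l, w' l < 4 * δ l.succ) → Wj w ≤ K * Wj w' := by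
      intro w w' hw hww' hw'w hw'
      simp only [hWj]
      rw [← lintegral_const_mul' _ _ hK]
      refine setLIntegral_mono' measurableSet_Ioo fun t ht => ?_
      rw [mul_left_comm]
      refine mul_le_mul_right ?_ _
      refine hmono _ _ ?_ ?_ ?_ ?_
      · exact Fin.cases (by simpa using ht.1) (fun l => by simpa using hw l)
      · exact Fin.cases (by simp) (fun l => by simpa using hww' l)
      · exact Fin.cases (by simp; linarith [ht.1]) (fun l => by simpa using hw'w l)
      · exact Fin.cases (by simp; linarith [ht.1, ht.2]) (fun l => by simpa using hw' l)
    -- the induction hypothesis for the `j`-th slice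
    have hIH := hn (cj j) Wj hWjm K hK (fun l => δ l.succ) hmonoj e'
    -- left-hand side
    have hF₁m : Measurable fun w : Fin (n + 1) → ℝ =>
        ENNReal.ofReal (|c e| * mono (fun l => (e l : ℕ)) w) * W w :=
      (ENNReal.measurable_ofReal.comp (continuous_const.mul (continuous_mono _)).measurable).mul hW
    have hL : ∫⁻ w in box δ, ENNReal.ofReal (|c e| * mono (fun l => (e l : ℕ)) w) * W w =
        ∫⁻ w' in box (fun l => δ l.succ),
          ENNReal.ofReal (|cj j e'| * mono (fun l => (e' l : ℕ)) w') * Wj w' := by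
      rw [lintegral_box_cons δ _ hF₁m]
      refine setLIntegral_congr_fun (measurableSet_box _) fun w' hw' => ?_
      simp only [hWj]
      have hm : Measurable fun t : ℝ => ENNReal.ofReal (t ^ (j : ℕ)) * W (Fin.cons t w') :=
        (ENNReal.measurable_ofReal.comp (measurable_id.pow_const _)).mul (hWcons w')
      rw [← lintegral_const_mul _ hm]
      refine setLIntegral_congr_fun measurableSet_Ioo fun t ht => ?_
      have hpt : |c e| * mono (fun l => (e l : ℕ)) (Fin.cons t w') =
          (|cj j e'| * mono (fun l => (e' l : ℕ)) w') * t ^ (j : ℕ) := by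
        rw [mono_coe_cons, hce]
        simp only [hj, he']
        ring
      rw [hpt, ENNReal.ofReal_mul' (pow_nonneg ht.1.le _), mul_assoc]
    -- right-hand side: the one-variable split at every point of the small box of the tail
    have hF₂m : Measurable fun w : Fin (n + 1) → ℝ => ENNReal.ofReal |pevn c w| * W w :=
      (ENNReal.measurable_ofReal.comp (continuous_pevn c).measurable.abs).mul hW
    have hR : ∫⁻ w' in box (fun l => 4 * δ l.succ), ENNReal.ofReal |pevn (cj j) w'| * Wj w' ≤
        A₁ * K * ∫⁻ w in box (fun l => 4 * δ l), ENNReal.ofReal |pevn c w| * W w := by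
      rw [lintegral_box_cons (fun l => 4 * δ l) _ hF₂m, ← lintegral_const_mul' _ _
        (ENNReal.mul_ne_top hA₁ hK)]
      refine setLIntegral_mono' (measurableSet_box _) fun w' hw' => ?_
      have hsplit := h₁ (fun j' => pevn (cj j') w') (fun t => W (Fin.cons t w')) (hWcons w') K hK
        (δ 0) (fun t t' ht htt' ht't ht' => hmono _ _
          (Fin.cases (by simpa using ht) (fun l => by simpa using (mem_box.1 hw' l).1))
          (Fin.cases (by simpa using htt') (fun l => by simp))
          (Fin.cases (by simpa using ht't) (fun l => by simp; linarith [(mem_box.1 hw' l).1]))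
          (Fin.cases (by simpa using ht') (fun l => by simpa using (mem_box.1 hw' l).2))) j
      have hl : ENNReal.ofReal |pevn (cj j) w'| * Wj w' =
          ∫⁻ t in Ioo 0 (δ 0), ENNReal.ofReal (|pevn (cj j) w'| * t ^ (j : ℕ)) * W (Fin.cons t w') := by
        simp only [hWj]
        have hm : Measurable fun t : ℝ => ENNReal.ofReal (t ^ (j : ℕ)) * W (Fin.cons t w') :=
          (ENNReal.measurable_ofReal.comp (measurable_id.pow_const _)).mul (hWcons w')
        rw [← lintegral_const_mul _ hm]
        refine setLIntegral_congr_fun measurableSet_Ioo fun t ht => ?_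
        rw [← mul_assoc, ← ENNReal.ofReal_mul (abs_nonneg _)]
      have hr : ∀ t, ENNReal.ofReal |pev (fun j' => pevn (cj j') w') t| * W (Fin.cons t w') =
          ENNReal.ofReal |pevn c (Fin.cons t w')| * W (Fin.cons t w') := by
        intro t; rw [pevn_cons]
      rw [hl]
      simp only [hr] at hsplit
      exact hsplit
    -- assemble
    calc ∫⁻ w in box δ, ENNReal.ofReal (|c e| * mono (fun l => (e l : ℕ)) w) * W w
        = ∫⁻ w' in box (fun l => δ l.succ),
            ENNReal.ofReal (|cj j e'| * mono (fun l => (e' l : ℕ)) w') * Wj w' := hL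
      _ ≤ An * K ^ n * ∫⁻ w' in box (fun l => 4 * δ l.succ),
            ENNReal.ofReal |pevn (cj j) w'| * Wj w' := hIH
      _ ≤ An * K ^ n * (A₁ * K * ∫⁻ w in box (fun l => 4 * δ l),
            ENNReal.ofReal |pevn c w| * W w) := mul_le_mul_right hR _
      _ = An * A₁ * K ^ (n + 1) * ∫⁻ w in box (fun l => 4 * δ l),
            ENNReal.ofReal |pevn c w| * W w := by rw [pow_succ]; ring

/-- **The monomial split in `n` variables** (qualitative form). -/
theorem monoSplit_lt_top (c : (Fin n → Fin (d + 1)) → ℝ) (W : (Fin n → ℝ) → ℝ≥0∞)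
    (hW : Measurable W) (K : ℝ≥0∞) (hK : K ≠ ∞) (δ : Fin n → ℝ)
    (hmono : ∀ w w' : Fin n → ℝ, (∀ l, 0 < w l) → (∀ l, w l ≤ w' l) → (∀ l, w' l ≤ 4 * w l) →
      (∀ l, w' l < 4 * δ l) → W w ≤ K * W w')
    (hfin : ∫⁻ w in box (fun l => 4 * δ l), ENNReal.ofReal |pevn c w| * W w < ∞)
    (e : Fin n → Fin (d + 1)) :
    ∫⁻ w in box δ, ENNReal.ofReal (|c e| * mono (fun l => (e l : ℕ)) w) * W w < ∞ := by
  obtain ⟨A, hA, h⟩ := monoSplit_le n d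
  exact (h c W hW K hK δ hmono e).trans_lt
    (ENNReal.mul_lt_top (ENNReal.mul_lt_top hA.lt_top (ENNReal.pow_lt_top hK.lt_top)) hfin)

end SepAll

/-- **The monomial split under an almost-decreasing weight in any number of variables**
(registered part of `stub_separateHigh_hH`; literal form of `SepAll.monoSplit_lt_top`): if a
measurable weight `W ≥ 0` on the big box `∏ (0, 4 δ l)` is almost decreasing towards the corner at
ratio `4` (constant `K < ∞`) and the polynomial `∑ c e' ∏ w_l^{e' l}` is absolutely `W`-integrable
there, then so is every monomial `c e ∏ w_l^{e l}` on `∏ (0, δ l)`. -/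
theorem separateAllHH_monoSplit (n d : ℕ) (c : (Fin n → Fin (d + 1)) → ℝ) (W : (Fin n → ℝ) → ENNReal) (hW : Measurable W) (K : ENNReal) (hK : K ≠ ⊤) (δ : Fin n → ℝ) (hmono : ∀ w w' : Fin n → ℝ, (∀ l, 0 < w l) → (∀ l, w l ≤ w' l) → (∀ l, w' l ≤ 4 * w l) → (∀ l, w' l < 4 * δ l) → W w ≤ K * W w') (hfin : MeasureTheory.lintegral (MeasureTheory.volume.restrict (Set.univ.pi fun l => Set.Ioo 0 (4 * δ l))) (fun w => ENNReal.ofReal |∑ e' : Fin n → Fin (d + 1), c e' * ∏ l, w l ^ (e' l : ℕ)| * W w) < ⊤) (e : Fin n → Fin (d + 1)) : MeasureTheory.lintegral (MeasureTheory.volume.restrict (Set.univ.pi fun l => Set.Ioo 0 (δ l))) (fun w => ENNReal.ofReal (|c e| * ∏ l, w l ^ (e l : ℕ)) * W w) < ⊤ := by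
  exact SepAll.monoSplit_lt_top c W hW K hK δ hmono hfin e

end Summit.KontsevichZagierPeriods.ArrangementNormalForm.JanusBands
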